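import Mathlib
import HarnessLib
import Summits.KontsevichZagierPeriods.Zeta5Search.Denom.LineProfileShape

/-!
# The second-tale line profile at P15 and its shape at `ξ = −897/100` (DecayT, one-variable side)

HONEST FRAMING: systematic search; no irrationality claim unless certified.  This file proves
elementary real-analysis facts about an explicit function of one variable; no statement about
`ζ(2)`, `ζ(5)` or any linear form is made here.

Cell pub-zeta5, P1 g10 for fam-measure g5's U2 chain (`DecayT c′`, the decay of Zudilin's second tale at
the Remark-5 partner `(32n+2; 11n+1, 13n+1, 15n+1 | 15n+2; 6n+1, 24n+2, 26n+2)` of P15, cf.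
`families/denom/P15KERNEL.md` §10.2).  In the variable `w = t/n = ξ + iη` the rational function
`R̂(t) = ∏_{j=15n+2}^{32n+1}(2t+j)/(17n)! · ∏_{j=6n+1}^{11n}(t+j)/(5n)! · (11n)!²/(∏_{k=13n+1}^{24n+1}(t+k)∏_{k=15n+1}^{26n+1}(t+k))`
has the scaled line profile — with the generic primitive `gPrim` of `Denom/LineProfile.lean` —
`profileT ξ η = profileT0 ξ η − 2π|η|`,
`profileT0 ξ η = 2(gPrim η (ξ+16) − gPrim η (ξ+15/2)) + (gPrim η (ξ+11) − gPrim η (ξ+6))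
 − (gPrim η (ξ+24) − gPrim η (ξ+13)) − (gPrim η (ξ+26) − gPrim η (ξ+15)) + profileTConst`,
`profileTConst = 22 log 11 − 17 log 17 − 5 log 5 + 17 log 2` (the doubled block:
`∫₁₅³² log|2w+s| ds = 17 log 2 + 2∫_{15/2}^{16} log|w+s′| ds′`).  This is the exact analogue of
`Denom/RungALineProfileShape.lean` (fam-denom g7), whose proofs are followed line by line.  On the line
`ξ = −897/100` put `PT η = profileT (−897/100) η`, `DT η = angleT (−897/100) η − 2π`:

* `DT_eq`: `DT = numLegsT − denAngleT1 − denAngleT2 − 2π`, numerator legs `2·arctan(703/(100η)) +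
  2·arctan(147/(100η)) + arctan(203/(100η)) + arctan(297/(100η))` (antitone), denominator angles
  `arctan (11η/(η² + 605709/10000))`, `arctan (11η/(η² + 1026909/10000))` (monotone on `(0, 7]`).
* `DT_antitoneOn` (`PT` concave on `(0, 7]`), `DT_neg_of_ge`, `DT_le_neg_three` (`η ≥ 7`), `PT_tail`.
* `twoPoint`: if `0 < η₁ ≤ η₂ ≤ 7`, `0 ≤ DT η₁`, `DT η₂ ≤ 0` then `PT η ≤ PT η₁ + DT η₁ (η₂ − η₁)` for all
  `η > 0`;  `PT_eq`: `PT` as eight signed values `gPrim η (p/100)` plus `profileTConst − 2π|η|`.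

The numerical instance (design optimum `η* = 1.29150`, `sup PT = −29.1078672…`) is certified in
`TwoTaleP15SecondLineCertificate.lean`.
-/

noncomputable section

open Real Set

namespace Summit.KontsevichZagierPeriods.Zeta5Search.TwoTaleP15SecondLineProfileShape

open Summit.KontsevichZagierPeriods.Zeta5Search.Denom.LineProfile
open Summit.KontsevichZagierPeriods.Zeta5Search.Denom.LineProfileShape (arctan_div_anti)

/-! ## The second-tale profile (generic abscissa `ξ`) -/

/-- The constant `22 log 11 − 17 log 17 − 5 log 5 + 17 log 2` of the second-tale profile. -/
def profileTConst : ℝ :=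
  22 * Real.log 11 - 17 * Real.log 17 - 5 * Real.log 5 + 17 * Real.log 2

/-- `profileT0 ξ η`: the `2π|η|`-free part of the second-tale line profile at abscissa `ξ` —
doubled numerator block `(ξ+16 | ξ+15/2)` with weight `2`, numerator block `(ξ+11 | ξ+6)`,
denominator blocks `(ξ+24 | ξ+13)`, `(ξ+26 | ξ+15)`, and `profileTConst`. -/
def profileT0 (ξ η : ℝ) : ℝ :=
  2 * (gPrim η (ξ + 16) - gPrim η (ξ + 15 / 2)) + (gPrim η (ξ + 11) - gPrim η (ξ + 6))
    - (gPrim η (ξ + 24) - gPrim η (ξ + 13)) - (gPrim η (ξ + 26) - gPrim η (ξ + 15)) + profileTConst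

/-- The second-tale line profile `profileT ξ η = profileT0 ξ η − 2π|η|`. -/
def profileT (ξ η : ℝ) : ℝ := profileT0 ξ η - 2 * Real.pi * |η|

/-- `angleT ξ η`: the `η`-derivative of `profileT0 ξ` (a signed sum of eight angles). -/
def angleT (ξ η : ℝ) : ℝ :=
  2 * (Real.arctan ((ξ + 16) / η) - Real.arctan ((ξ + 15 / 2) / η))
    + (Real.arctan ((ξ + 11) / η) - Real.arctan ((ξ + 6) / η))
    - (Real.arctan ((ξ + 24) / η) - Real.arctan ((ξ + 13) / η))
    - (Real.arctan ((ξ + 26) / η) - Real.arctan ((ξ + 15) / η))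

/-- `profileT0` is even in `η`. -/
theorem profileT0_neg_eta (ξ η : ℝ) : profileT0 ξ (-η) = profileT0 ξ η := by
  simp only [profileT0, gPrim_neg_eta]

/-- `profileT` is even in `η`. -/
theorem profileT_neg_eta (ξ η : ℝ) : profileT ξ (-η) = profileT ξ η := by
  simp only [profileT, profileT0_neg_eta, abs_neg]

/-- `d/dη profileT0 ξ η = angleT ξ η` for `η ≠ 0`. -/
theorem hasDerivAt_profileT0_eta (ξ : ℝ) {η : ℝ} (hη : η ≠ 0) :
    HasDerivAt (fun η : ℝ => profileT0 ξ η) (angleT ξ η) η := by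
  have h := fun w => hasDerivAt_gPrim_eta hη w
  have key := (((((h (ξ + 16)).sub (h (ξ + 15 / 2))).const_mul 2).add ((h (ξ + 11)).sub (h (ξ + 6)))).sub
    ((h (ξ + 24)).sub (h (ξ + 13)))).sub ((h (ξ + 26)).sub (h (ξ + 15))) |>.add_const profileTConst
  exact key

/-- `d/dη profileT ξ η = angleT ξ η − 2π` for `η > 0`. -/
theorem hasDerivAt_profileT_eta (ξ : ℝ) {η : ℝ} (hη : 0 < η) :
    HasDerivAt (fun η : ℝ => profileT ξ η) (angleT ξ η - 2 * Real.pi) η := by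
  have habs : HasDerivAt (fun η : ℝ => 2 * Real.pi * |η|) (2 * Real.pi * 1) η := by
    refine ((hasDerivAt_id' η).congr_of_eventuallyEq ?_).const_mul (2 * Real.pi)
    filter_upwards [Ioi_mem_nhds hη] with x hx using abs_of_pos hx
  have key : HasDerivAt (fun η : ℝ => profileT0 ξ η - 2 * Real.pi * |η|)
      (angleT ξ η - 2 * Real.pi * 1) η := (hasDerivAt_profileT0_eta ξ hη.ne').sub habs
  rw [mul_one] at key
  exact key

/-- `profileT ξ` is continuous on `(0, ∞)`. -/
theorem continuousOn_profileT (ξ : ℝ) : ContinuousOn (fun η : ℝ => profileT ξ η) (Ioi 0) :=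
  fun _ hη => (hasDerivAt_profileT_eta ξ hη).continuousAt.continuousWithinAt

/-! ## The line `ξ = −897/100` -/

/-- `PT η = profileT (−897/100) η`, the second-tale line profile on the saddle line `ξ = −8.97`. -/
def PT (η : ℝ) : ℝ := profileT (-897 / 100) η

/-- `DT η = angleT (−897/100) η − 2π` (the derivative of `PT` on `(0, ∞)`). -/
def DT (η : ℝ) : ℝ := angleT (-897 / 100) η - 2 * Real.pi

/-- The numerator legs: `2·arctan(703/(100η)) + 2·arctan(147/(100η)) + arctan(203/(100η)) + arctan(297/(100η))`. -/
def numLegsT (η : ℝ) : ℝ :=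
  2 * Real.arctan (703 / 100 / η) + 2 * Real.arctan (147 / 100 / η)
    + Real.arctan (203 / 100 / η) + Real.arctan (297 / 100 / η)

/-- The first denominator angle `arctan (1503/(100η)) − arctan (403/(100η))`. -/
def denAngleT1 (η : ℝ) : ℝ := Real.arctan (1503 / 100 / η) - Real.arctan (403 / 100 / η)

/-- The second denominator angle `arctan (1703/(100η)) − arctan (603/(100η))`. -/
def denAngleT2 (η : ℝ) : ℝ := Real.arctan (1703 / 100 / η) - Real.arctan (603 / 100 / η)

/-- `d/dη PT = DT` on `(0, ∞)`. -/
theorem hasDerivAt_PT {η : ℝ} (hη : 0 < η) : HasDerivAt PT (DT η) η :=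
  hasDerivAt_profileT_eta (-897 / 100) hη

/-- `DT = numLegsT − denAngleT1 − denAngleT2 − 2π`. -/
theorem DT_eq (η : ℝ) : DT η = numLegsT η - denAngleT1 η - denAngleT2 η - 2 * Real.pi := by
  simp only [DT, angleT, numLegsT, denAngleT1, denAngleT2]
  have e1 : ((-897 : ℝ) / 100 + 16) / η = 703 / 100 / η := by ring
  have e2 : ((-897 : ℝ) / 100 + 15 / 2) / η = -(147 / 100 / η) := by ring
  have e3 : ((-897 : ℝ) / 100 + 11) / η = 203 / 100 / η := by ring
  have e4 : ((-897 : ℝ) / 100 + 6) / η = -(297 / 100 / η) := by ring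
  have e5 : ((-897 : ℝ) / 100 + 24) / η = 1503 / 100 / η := by ring
  have e6 : ((-897 : ℝ) / 100 + 13) / η = 403 / 100 / η := by ring
  have e7 : ((-897 : ℝ) / 100 + 26) / η = 1703 / 100 / η := by ring
  have e8 : ((-897 : ℝ) / 100 + 15) / η = 603 / 100 / η := by ring
  rw [e1, e2, e3, e4, e5, e6, e7, e8, Real.arctan_neg, Real.arctan_neg]
  ring

/-- `PT = (eight signed values of gPrim) + profileTConst − 2π|η|`. -/
theorem PT_eq (η : ℝ) : PT η =
    2 * gPrim η (703 / 100) + 2 * gPrim η (147 / 100) + gPrim η (203 / 100) + gPrim η (297 / 100)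
      - gPrim η (1503 / 100) + gPrim η (403 / 100) - gPrim η (1703 / 100) + gPrim η (603 / 100)
      + profileTConst - 2 * Real.pi * |η| := by
  simp only [PT, profileT, profileT0]
  have e1 : gPrim η ((-897 : ℝ) / 100 + 16) = gPrim η (703 / 100) := by norm_num
  have e2 : gPrim η ((-897 : ℝ) / 100 + 15 / 2) = -gPrim η (147 / 100) := by
    rw [show ((-897 : ℝ) / 100 + 15 / 2) = -(147 / 100) by norm_num, gPrim_neg]
  have e3 : gPrim η ((-897 : ℝ) / 100 + 11) = gPrim η (203 / 100) := by norm_num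
  have e4 : gPrim η ((-897 : ℝ) / 100 + 6) = -gPrim η (297 / 100) := by
    rw [show ((-897 : ℝ) / 100 + 6) = -(297 / 100) by norm_num, gPrim_neg]
  have e5 : gPrim η ((-897 : ℝ) / 100 + 24) = gPrim η (1503 / 100) := by norm_num
  have e6 : gPrim η ((-897 : ℝ) / 100 + 13) = gPrim η (403 / 100) := by norm_num
  have e7 : gPrim η ((-897 : ℝ) / 100 + 26) = gPrim η (1703 / 100) := by norm_num
  have e8 : gPrim η ((-897 : ℝ) / 100 + 15) = gPrim η (603 / 100) := by norm_num
  rw [e1, e2, e3, e4, e5, e6, e7, e8]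
  ring

/-- Closed form `denAngleT1 η = arctan (11η / (η² + 605709/10000))` for `η > 0`. -/
theorem denAngleT1_eq {η : ℝ} (hη : 0 < η) :
    denAngleT1 η = Real.arctan (11 * η / (η ^ 2 + 605709 / 10000)) := by
  have hη' : η ≠ 0 := hη.ne'
  unfold denAngleT1
  have hx : 0 < 1503 / 100 / η := by positivity
  have hy : 0 < 403 / 100 / η := by positivity
  have h1 : (1503 / 100 / η) * (-(403 / 100 / η)) < 1 := by nlinarith
  rw [sub_eq_add_neg, ← Real.arctan_neg, Real.arctan_add h1]
  congr 1
  have hD1 : (1 - 1503 / 100 / η * -(403 / 100 / η)) ≠ 0 := by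
    have : 0 < 1 - 1503 / 100 / η * -(403 / 100 / η) := by nlinarith [mul_pos hx hy]
    exact this.ne'
  have hD2 : η ^ 2 + 605709 / 10000 ≠ 0 := by positivity
  rw [div_eq_div_iff hD1 hD2]
  field_simp
  ring

/-- Closed form `denAngleT2 η = arctan (11η / (η² + 1026909/10000))` for `η > 0`. -/
theorem denAngleT2_eq {η : ℝ} (hη : 0 < η) :
    denAngleT2 η = Real.arctan (11 * η / (η ^ 2 + 1026909 / 10000)) := by
  have hη' : η ≠ 0 := hη.ne'
  unfold denAngleT2
  have hx : 0 < 1703 / 100 / η := by positivity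
  have hy : 0 < 603 / 100 / η := by positivity
  have h1 : (1703 / 100 / η) * (-(603 / 100 / η)) < 1 := by nlinarith
  rw [sub_eq_add_neg, ← Real.arctan_neg, Real.arctan_add h1]
  congr 1
  have hD1 : (1 - 1703 / 100 / η * -(603 / 100 / η)) ≠ 0 := by
    have : 0 < 1 - 1703 / 100 / η * -(603 / 100 / η) := by nlinarith [mul_pos hx hy]
    exact this.ne'
  have hD2 : η ^ 2 + 1026909 / 10000 ≠ 0 := by positivity
  rw [div_eq_div_iff hD1 hD2]
  field_simp
  ring

/-- `denAngleT1` is monotone on `(0, 7]` (`7² ≤ 605709/10000`). -/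
theorem denAngleT1_mono {s t : ℝ} (hs : 0 < s) (hst : s ≤ t) (ht : t ≤ 7) :
    denAngleT1 s ≤ denAngleT1 t := by
  rw [denAngleT1_eq hs, denAngleT1_eq (hs.trans_le hst)]
  apply Real.arctan_mono
  rw [div_le_div_iff₀ (by positivity) (by positivity)]
  have hst' : s * t ≤ 7 * 7 := mul_le_mul (hst.trans ht) ht (hs.le.trans hst) (by norm_num)
  nlinarith [mul_nonneg (sub_nonneg.2 hst) (by linarith : (0 : ℝ) ≤ 605709 / 10000 - s * t)]

/-- `denAngleT2` is monotone on `(0, 7]` (`7² ≤ 1026909/10000`). -/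
theorem denAngleT2_mono {s t : ℝ} (hs : 0 < s) (hst : s ≤ t) (ht : t ≤ 7) :
    denAngleT2 s ≤ denAngleT2 t := by
  rw [denAngleT2_eq hs, denAngleT2_eq (hs.trans_le hst)]
  apply Real.arctan_mono
  rw [div_le_div_iff₀ (by positivity) (by positivity)]
  have hst' : s * t ≤ 7 * 7 := mul_le_mul (hst.trans ht) ht (hs.le.trans hst) (by norm_num)
  nlinarith [mul_nonneg (sub_nonneg.2 hst) (by linarith : (0 : ℝ) ≤ 1026909 / 10000 - s * t)]

/-- `DT` is antitone on `(0, 7]`. -/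
theorem DT_antitoneOn {s t : ℝ} (hs : 0 < s) (hst : s ≤ t) (ht : t ≤ 7) : DT t ≤ DT s := by
  rw [DT_eq, DT_eq]
  have hd1 := denAngleT1_mono hs hst ht
  have hd2 := denAngleT2_mono hs hst ht
  have l1 := arctan_div_anti (703 / 100) (by norm_num) hs hst
  have l2 := arctan_div_anti (147 / 100) (by norm_num) hs hst
  have l3 := arctan_div_anti (203 / 100) (by norm_num) hs hst
  have l4 := arctan_div_anti (297 / 100) (by norm_num) hs hst
  unfold numLegsT
  linarith

/-- The leg bound `arctan (c/η) ≤ c/7` for `η ≥ 7`, `c ≥ 0`. -/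
theorem leg_le {η c : ℝ} (hη : 7 ≤ η) (hc : 0 ≤ c) : Real.arctan (c / η) ≤ c / 7 := by
  have hη0 : 0 < η := by linarith
  refine (show Real.arctan (c / η) ≤ c / η from ?_).trans (div_le_div_of_nonneg_left hc (by norm_num) hη)
  have ht : (0 : ℝ) ≤ c / η := div_nonneg hc hη0.le
  have h0 : 0 ≤ Real.arctan (c / η) := by simpa using Real.arctan_mono ht
  have h := Real.le_tan h0 (Real.arctan_lt_pi_div_two _)
  rwa [Real.tan_arctan] at h

/-- Both denominator angles are nonnegative for `η > 0`. -/
theorem denAngles_nonneg {η : ℝ} (hη : 0 < η) : 0 ≤ denAngleT1 η ∧ 0 ≤ denAngleT2 η := by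
  unfold denAngleT1 denAngleT2
  have h1 : Real.arctan (403 / 100 / η) ≤ Real.arctan (1503 / 100 / η) :=
    Real.arctan_mono (div_le_div_of_nonneg_right (by norm_num) hη.le)
  have h2 : Real.arctan (603 / 100 / η) ≤ Real.arctan (1703 / 100 / η) :=
    Real.arctan_mono (div_le_div_of_nonneg_right (by norm_num) hη.le)
  constructor <;> linarith

/-- `DT η < 0` for `η ≥ 7` (`arctan x ≤ x`, `22/7 < 2π`). -/
theorem DT_neg_of_ge {η : ℝ} (hη : 7 ≤ η) : DT η < 0 := by
  rw [DT_eq]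
  have hη0 : 0 < η := by linarith
  obtain ⟨hd1, hd2⟩ := denAngles_nonneg hη0
  have l1 := leg_le hη (by norm_num : (0 : ℝ) ≤ 703 / 100)
  have l2 := leg_le hη (by norm_num : (0 : ℝ) ≤ 147 / 100)
  have l3 := leg_le hη (by norm_num : (0 : ℝ) ≤ 203 / 100)
  have l4 := leg_le hη (by norm_num : (0 : ℝ) ≤ 297 / 100)
  unfold numLegsT
  nlinarith [Real.pi_gt_three]

/-- `DT η ≤ −3` for `η ≥ 7` (`22/7 + 3 < 2π`). -/
theorem DT_le_neg_three {η : ℝ} (hη : 7 ≤ η) : DT η ≤ -3 := by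
  rw [DT_eq]
  have hη0 : 0 < η := by linarith
  obtain ⟨hd1, hd2⟩ := denAngles_nonneg hη0
  have l1 := leg_le hη (by norm_num : (0 : ℝ) ≤ 703 / 100)
  have l2 := leg_le hη (by norm_num : (0 : ℝ) ≤ 147 / 100)
  have l3 := leg_le hη (by norm_num : (0 : ℝ) ≤ 203 / 100)
  have l4 := leg_le hη (by norm_num : (0 : ℝ) ≤ 297 / 100)
  unfold numLegsT
  linarith [Real.pi_gt_d2]

/-- Tail slope: `PT η ≤ PT 7 − 3 (η − 7)` for `η ≥ 7` (mean value theorem and `DT_le_neg_three`). -/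
theorem PT_tail {η : ℝ} (hη : 7 ≤ η) : PT η ≤ PT 7 - 3 * (η - 7) := by
  rcases hη.eq_or_lt with h | hlt
  · rw [← h]
    simp
  have cont : ContinuousOn PT (Icc 7 η) :=
    (continuousOn_profileT (-897 / 100)).mono fun x hx => lt_of_lt_of_le (by norm_num) hx.1
  have deriv : ∀ x ∈ Ioo 7 η, HasDerivAt PT (DT x) x := fun x hx =>
    hasDerivAt_PT (lt_trans (by norm_num) hx.1)
  obtain ⟨ξ, hξ, hslope⟩ := exists_hasDerivAt_eq_slope PT DT hlt cont deriv
  have h3 : DT ξ ≤ -3 := DT_le_neg_three hξ.1.le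
  rw [hslope, div_le_iff₀ (by linarith)] at h3
  linarith

/-- **Two-point tangent lemma.**  If `0 < η₁ ≤ η₂ ≤ 7`, `0 ≤ DT η₁` and `DT η₂ ≤ 0`, then
`PT η ≤ PT η₁ + DT η₁ · (η₂ − η₁)` for every `η > 0`. -/
theorem twoPoint {η₁ η₂ : ℝ} (h1 : 0 < η₁) (h12 : η₁ ≤ η₂) (h2 : η₂ ≤ 7) (hD1 : 0 ≤ DT η₁)
    (hD2 : DT η₂ ≤ 0) {η : ℝ} (hη : 0 < η) : PT η ≤ PT η₁ + DT η₁ * (η₂ - η₁) := by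
  have cont : ∀ a b : ℝ, 0 < a → ContinuousOn PT (Icc a b) := fun a b ha =>
    (continuousOn_profileT (-897 / 100)).mono fun x hx => lt_of_lt_of_le ha hx.1
  have diff : ∀ a b : ℝ, 0 < a → DifferentiableOn ℝ PT (interior (Icc a b)) :=
    fun a b ha x hx => by
      rw [interior_Icc] at hx
      exact (hasDerivAt_PT (ha.trans hx.1)).differentiableAt.differentiableWithinAt
  have der : ∀ x : ℝ, 0 < x → deriv PT x = DT x := fun x hx => (hasDerivAt_PT hx).deriv
  have h2pos : 0 < η₂ := h1.trans_le h12
  have mid : ∀ y : ℝ, η₁ ≤ y → y ≤ η₂ → PT y - PT η₁ ≤ DT η₁ * (y - η₁) :=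
    fun y hy1 hy2 =>
    (convex_Icc η₁ y).image_sub_le_mul_sub_of_deriv_le (cont η₁ y h1) (diff η₁ y h1)
      (C := DT η₁)
      (fun x hx => by
        rw [interior_Icc] at hx
        rw [der x (h1.trans hx.1)]
        exact DT_antitoneOn h1 hx.1.le (by linarith [hx.2]))
      η₁ ⟨le_rfl, hy1⟩ y ⟨hy1, le_rfl⟩ hy1
  rcases le_total η η₁ with hle | hge
  · have mono : MonotoneOn PT (Icc η η₁) :=
      monotoneOn_of_deriv_nonneg (convex_Icc η η₁) (cont η η₁ hη) (diff η η₁ hη) fun x hx => by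
        rw [interior_Icc] at hx
        rw [der x (hη.trans hx.1)]
        exact hD1.trans (DT_antitoneOn (hη.trans hx.1) hx.2.le (h12.trans h2))
    have := mono ⟨le_rfl, hle⟩ ⟨hle, le_rfl⟩ hle
    nlinarith [mul_nonneg hD1 (sub_nonneg.2 h12)]
  · rcases le_total η η₂ with hle2 | hge2
    · have := mid η hge hle2
      nlinarith [mul_le_mul_of_nonneg_left (by linarith : η - η₁ ≤ η₂ - η₁) hD1]
    · have anti : AntitoneOn PT (Icc η₂ η) :=
        antitoneOn_of_deriv_nonpos (convex_Icc η₂ η) (cont η₂ η h2pos) (diff η₂ η h2pos)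
          fun x hx => by
            rw [interior_Icc] at hx
            rw [der x (h2pos.trans hx.1)]
            rcases le_or_gt x 7 with hx7 | hx7
            · exact (DT_antitoneOn h2pos hx.1.le hx7).trans hD2
            · exact (DT_neg_of_ge hx7.le).le
      have hA := anti ⟨le_rfl, hge2⟩ ⟨hge2, le_rfl⟩ hge2
      have := mid η₂ h12 le_rfl
      linarith

end Summit.KontsevichZagierPeriods.Zeta5Search.TwoTaleP15SecondLineProfileShape

end
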